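import Literature.NumberTheory.EllipticCurves.SteinWuthrich2013.NonsplitLogUniformizationProofs
import Literature.NumberTheory.EllipticCurves.SteinWuthrich2013.MultiplicativeHeightExistenceProofs
import Literature.NumberTheory.EllipticCurves.SteinWuthrich2013.MultiplicativeHeightThetaOfUniformizationProofs
import Literature.NumberTheory.EllipticCurves.SteinWuthrich2013.TateSigmaThetaProofs
import Literature.NumberTheory.EllipticCurves.SteinWuthrich2013.PadicExpLogCoshProofs
import Literature.NumberTheory.EllipticCurves.TateCurve.TateThetaRelation
import Mathlib.Analysis.SpecialFunctions.Log.Summable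
import HarnessLib

/-!
# Stein–Wuthrich 2013 §4.2: the canonical `p`-adic height at a NON-split multiplicative prime
# `p ≠ 2` EXISTS — discharge of the named fact `exists_isMultCanonical` (proofs only)

Topic `Literature/NumberTheory/EllipticCurves` (cluster `SteinWuthrich2013`); proof file. Cell
`bsd-eis`, seat `bsd-eis-k5-c4` g3: final step N5 of the discharge of
`SteinWuthrich2013.exists_isMultCanonical` (conjunct `hHn` of `stub_publishedFacts`, crux 4
`BSDpOnCellC`, stmt-BirchSwinnertonDyer-19034). Same composition as the split case
(`SplitMultCanonicalOfThetaRelationProofs`, `SplitMultCanonicalHolds`) but over `K = ℂ_p`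
(`ι : ℚ_p → ℂ_p`): `exists_isMultCanonical_of_theta_nonsplit` + `tateSigma_input_of_uniformization`
with the uniformisation data of `exists_nonsplitUniformizationData`, the value identity
`hυσ` from `padicFormalLog_param_eq_inv_u_mul_logSeries`, `PadicAlgebra.coshOfSq_logSeries_sq` and
`tateSigmaSq_cosh_eq`, and Silverman's theta relation `TateCurve.tate_thetaRelation` over `ℂ_p`.

* `algebraMap_uniformisationScaleSq` — `ι(scale²) = u⁻²` for `C • (W ⊗ ℂ_p) = E_q`;
* `algebraMap_tateSigmaSq`, `algebraMap_coshOfSq` — `ι` commutes with `σ_q²` and `cosh`;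
* `tateSigmaSq_coshOfSq_logUnitParamSq_eq_padicComplex` — the value hypothesis `hυσ` in `ℂ_p`;
* `tateSigma_input_nonsplit` — the inputs `hS0`, `hΘ` of `exists_isMultCanonical_of_theta_nonsplit`;
* `exists_isMultCanonical_holds : exists_isMultCanonical`.

## Sources
* W. Stein, C. Wuthrich, Math. Comp. 82 (2013), §4.2 (pp. 15–16), §6.1. [SteinWuthrich2013]
* J. H. Silverman, *Advanced Topics in the Arithmetic of Elliptic Curves* (1994), Prop. V.3.2,
  Thm. V.5.3. [SilvermanATAEC1994]
-/

noncomputable section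

open scoped Classical

open Filter Topology WeierstrassCurve Literature.NumberTheory.EllipticCurves
  Literature.NumberTheory.EllipticCurves.TateCurve Literature.NumberTheory.LocalFields
  Literature.NumberTheory.Transcendental

namespace Literature.NumberTheory.EllipticCurves.SteinWuthrich2013

variable {W : WeierstrassCurve ℚ} {p : ℕ} [hp : Fact p.Prime]

/-- `‖(x : ℂ_p)‖ = ‖x‖_p`. [folklore] -/
private theorem norm_ι'' (x : ℚ_[p]) : ‖algebraMap ℚ_[p] ℂ_[p] x‖ = ‖x‖ := norm_algebraMap' ℂ_[p] x

/-- In a normed field, `∏ f = a ≠ 0` gives `∏ f⁻¹ = a⁻¹`. [folklore] -/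
private theorem hasProd_inv_of_ne_zero'' {L : Type*} [NormedField L] {f : ℕ → L} {a : L}
    (h : HasProd f a) (ha : a ≠ 0) : HasProd (fun n => (f n)⁻¹) a⁻¹ := by
  unfold HasProd at h ⊢
  have := h.inv₀ ha
  refine this.congr fun s => ?_
  exact (Finset.prod_inv_distrib (s := s) (f := f)).symm

/-! ### `ι` and the `q`-series -/

/-- **The factors of `tateSigmaSq q c` have an unconditional product** (any `c`, `‖q‖ < 1`, complete
normed field): `1 − 2qⁿc + q^{2n} = 1 + O(qⁿ)` is summably close to `1` and `∏(1−qⁿ)⁴ ≠ 0`.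
[cite: SteinWuthrich2013, §4.2 (p. 15)] -/
theorem hasProd_tateSigmaSq_factor' {L : Type*} [NormedField L] [CompleteSpace L] {q : L}
    (hq : ‖q‖ < 1) (c : L) :
    HasProd (fun n : ℕ => (1 - 2 * q ^ (n + 1) * c + q ^ (2 * (n + 1))) ^ 2 / (1 - q ^ (n + 1)) ^ 4)
      ((∏' n : ℕ, (1 + (-(2 * q ^ (n + 1) * c) + q ^ (2 * (n + 1))))) ^ 2 / tateP q 1 ^ 4) := by
  have hsum : Summable fun n : ℕ => ‖-(2 * q ^ (n + 1) * c) + q ^ (2 * (n + 1))‖ := by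
    have hg := summable_geometric_of_lt_one (norm_nonneg q) hq
    have h1 : Summable fun n : ℕ => 2 * ‖c‖ * ‖q‖ ^ (n + 1) :=
      ((hg.mul_left ‖q‖).mul_left (2 * ‖c‖)).congr fun n => by rw [pow_succ]; ring
    have h2 : Summable fun n : ℕ => ‖q‖ ^ (2 * (n + 1)) := by
      have hq2 : ‖q‖ ^ 2 < 1 := pow_lt_one₀ (norm_nonneg q) hq two_ne_zero
      have := (summable_geometric_of_lt_one (sq_nonneg ‖q‖) hq2).mul_left (‖q‖ ^ 2)
      refine this.congr fun n => ?_
      rw [← pow_succ', ← pow_mul]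
    have h2n : ‖(2 : L)‖ ≤ 2 := by simpa using Nat.norm_cast_le (α := L) 2
    refine Summable.of_nonneg_of_le (fun _ => norm_nonneg _) (fun n => ?_) (h1.add h2)
    refine (norm_add_le _ _).trans (add_le_add ?_ (by rw [norm_pow]))
    rw [norm_neg, norm_mul, norm_mul, norm_pow]
    have := mul_le_mul_of_nonneg_right h2n
      (mul_nonneg (pow_nonneg (norm_nonneg q) (n + 1)) (norm_nonneg c))
    nlinarith [norm_nonneg c, pow_nonneg (norm_nonneg q) (n + 1), this]
  have hA := (multipliable_one_add_of_summable hsum).hasProd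
  have hP1 : tateP q (1 : L) ≠ 0 := tateP_one_ne_zero hq
  have hden : HasProd (fun n : ℕ => ((1 - q ^ (n + 1) * (1 : L)) ^ 4)⁻¹) (tateP q 1 ^ 4)⁻¹ :=
    hasProd_inv_of_ne_zero'' ((hasProd_tateP hq (1 : L)).pow 4) (pow_ne_zero 4 hP1)
  have hall := (hA.pow 2).mul hden
  rw [← div_eq_mul_inv] at hall
  refine hall.congr_fun fun n => ?_
  simp only [mul_one, div_eq_mul_inv]
  ring

/-- **`ι` commutes with `σ_q²`**: `ι (tateSigmaSq q c) = tateSigmaSq (ι q) (ι c)` for the continuous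
embedding `ι : ℚ_p → ℂ_p` and `‖q‖ < 1` (the product converges unconditionally on both sides).
[cite: SteinWuthrich2013, §4.2 (p. 15)] -/
theorem algebraMap_tateSigmaSq {q : ℚ_[p]} (hq : ‖q‖ < 1) (c : ℚ_[p]) :
    algebraMap ℚ_[p] ℂ_[p] (tateSigmaSq q c) =
      tateSigmaSq (algebraMap ℚ_[p] ℂ_[p] q) (algebraMap ℚ_[p] ℂ_[p] c) := by
  set ι := algebraMap ℚ_[p] ℂ_[p]
  have h := hasProd_tateSigmaSq_factor' hq c
  have hmap := h.map (ι : ℚ_[p] →* ℂ_[p]) (continuous_algebraMap ℚ_[p] ℂ_[p])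
  have hq' : ‖ι q‖ < 1 := by rw [norm_ι'']; exact hq
  have h' := hasProd_tateSigmaSq_factor' hq' (ι c)
  have hfun : ((ι : ℚ_[p] →* ℂ_[p]) ∘ fun n : ℕ =>
      (1 - 2 * q ^ (n + 1) * c + q ^ (2 * (n + 1))) ^ 2 / (1 - q ^ (n + 1)) ^ 4) =
      fun n : ℕ => (1 - 2 * ι q ^ (n + 1) * ι c + ι q ^ (2 * (n + 1))) ^ 2 / (1 - ι q ^ (n + 1)) ^ 4 := by
    funext n
    simp only [Function.comp_apply, MonoidHom.coe_coe, map_div₀, map_pow, map_add, map_sub, map_one,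
      map_mul, map_ofNat]
  rw [hfun] at hmap
  have hval := hmap.unique h'
  simp only [MonoidHom.coe_coe] at hval
  unfold tateSigmaSq
  rw [h.tprod_eq, h'.tprod_eq, map_mul, hval]
  simp only [map_mul, map_sub, map_one, map_ofNat]

/-- **`ι` commutes with `cosh`**: `ι (coshOfSq w) = coshOfSq (ι w)` for `‖w‖ ≤ p⁻²`, `p ≠ 2` (the
series `Σ wⁿ/(2n)!` converges absolutely: `‖wⁿ/(2n)!‖ ≤ p^{−2n} p^{v_p((2n)!)} ≤ p⁻ⁿ`).
[cite: SteinWuthrich2013, §4.2 (p. 15)] -/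
theorem algebraMap_coshOfSq (hp2 : p ≠ 2) {w : ℚ_[p]} (hw : ‖w‖ ≤ ((p : ℝ)⁻¹) ^ 2) :
    algebraMap ℚ_[p] ℂ_[p] (coshOfSq w) = coshOfSq (algebraMap ℚ_[p] ℂ_[p] w) := by
  set ι := algebraMap ℚ_[p] ℂ_[p]
  have hp0 : (0 : ℝ) < p := by exact_mod_cast hp.out.pos
  have hp1 : (1 : ℝ) ≤ p := by exact_mod_cast hp.out.one_lt.le
  have hpinv1 : (p : ℝ)⁻¹ < 1 := inv_lt_one_of_one_lt₀ (by exact_mod_cast hp.out.one_lt)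
  -- absolute convergence in `ℚ_p`
  have hS : Summable fun n : ℕ => w ^ n / ((2 * n).factorial : ℚ_[p]) := by
    have hg : Summable fun n : ℕ => ((p : ℝ)⁻¹) ^ n :=
      summable_geometric_of_lt_one (inv_nonneg.mpr hp0.le) hpinv1
    refine Summable.of_norm_bounded hg fun n => ?_
    rw [norm_div, div_eq_mul_inv, ← norm_inv, norm_pow, norm_inv_factorial (2 * n)]
    have hv : padicValNat p (2 * n).factorial ≤ n := by
      have := two_mul_padicValNat_factorial_le hp2 (2 * n); omega
    calc ‖w‖ ^ n * (p : ℝ) ^ (padicValNat p (2 * n).factorial : ℤ)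
        ≤ (((p : ℝ)⁻¹) ^ 2) ^ n * (p : ℝ) ^ (n : ℤ) := by
          refine mul_le_mul (pow_le_pow_left₀ (norm_nonneg _) hw n)
            (zpow_le_zpow_right₀ hp1 (by exact_mod_cast hv)) (by positivity) (by positivity)
      _ = ((p : ℝ)⁻¹) ^ n := by
          rw [zpow_natCast, ← pow_mul, inv_pow, inv_pow]
          field_simp
          ring
  have h := hS.hasSum
  have hmap := h.map (ι : ℚ_[p] →+ ℂ_[p]) (continuous_algebraMap ℚ_[p] ℂ_[p])
  have hfun : ((ι : ℚ_[p] →+ ℂ_[p]) ∘ fun n : ℕ => w ^ n / ((2 * n).factorial : ℚ_[p])) =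
      fun n : ℕ => ι w ^ n / ((2 * n).factorial : ℂ_[p]) := by
    funext n
    simp only [Function.comp_apply, AddMonoidHom.coe_coe, map_div₀, map_pow, map_natCast]
  rw [hfun] at hmap
  have hval := hmap.tsum_eq
  simp only [AddMonoidHom.coe_coe] at hval
  unfold coshOfSq
  rw [hval]

/-! ### The scale and the value identity in `ℂ_p` -/

/-- **SW's scale is `u⁻²` (non-split case, over `ℂ_p`)**: if `C • (W ⊗ ℂ_p) = E_q` (`C = (u,r,s,t)`)
and `‖j(W)‖_p > 1` then `ι (uniformisationScaleSq W p q) = (u⁻¹)²`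
(`c₄(E_q) = u⁻⁴c₄`, `c₆(E_q) = u⁻⁶c₆`, AEC III.1 Table 3.1). [cite: SteinWuthrich2013, §4.2 (p. 15)]
[cite: SilvermanAEC2009, III.1 Table 3.1] -/
theorem algebraMap_uniformisationScaleSq [W.IsElliptic] {q : ℚ_[p]} (hq : ‖q‖ < 1)
    {C : VariableChange ℂ_[p]}
    (hC : C • (W.baseChange ℚ_[p]).map (algebraMap ℚ_[p] ℂ_[p]) = tateCurve (algebraMap ℚ_[p] ℂ_[p] q))
    (hj : 1 < ‖(W.j : ℚ_[p])‖) :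
    algebraMap ℚ_[p] ℂ_[p] (uniformisationScaleSq W p q) = ((C.u : ℂ_[p])⁻¹) ^ 2 := by
  set ι := algebraMap ℚ_[p] ℂ_[p] with hι
  set E₀ : WeierstrassCurve ℚ_[p] := W.baseChange ℚ_[p] with hE₀
  set E : WeierstrassCurve ℂ_[p] := E₀.map ι with hE
  have hE₀j : E₀.j = (W.j : ℚ_[p]) := by
    show (W.map (algebraMap ℚ ℚ_[p])).j = _
    rw [WeierstrassCurve.map_j, eq_ratCast]
  have hEj : E.j = ι E₀.j := WeierstrassCurve.map_j E₀ ι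
  have hj' : 1 < ‖E.j‖ := by rw [hEj, norm_ι'', hE₀j]; exact hj
  obtain ⟨hj0, hj1728⟩ := j_ne_zero_and_ne_1728_of_one_lt_norm hj'
  have hc4 : E.c₄ ≠ 0 := by
    intro h0
    apply hj0
    rw [WeierstrassCurve.j, h0]
    ring
  have hc6 : E.c₆ ≠ 0 := by
    intro h0
    apply hj1728
    have hrel := E.c_relation
    rw [h0] at hrel
    rw [WeierstrassCurve.j, show E.c₄ ^ 3 = 1728 * E.Δ by linear_combination -hrel, ← E.coe_Δ',
      mul_comm (1728 : ℂ_[p]), ← mul_assoc, Units.inv_mul, one_mul]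
  have hmap : (tateCurve q).map ι = tateCurve (ι q) :=
    tateCurve_map ι (continuous_algebraMap ℚ_[p] ℂ_[p]) hq
  have hu : ((C.u⁻¹ : ℂ_[p]ˣ) : ℂ_[p]) = (C.u : ℂ_[p])⁻¹ := Units.val_inv_eq_inv_val _
  unfold uniformisationScaleSq
  rw [map_div₀, map_mul, map_mul, ← map_c₄ (tateCurve q) ι, ← map_c₆ (tateCurve q) ι, hmap,
    ← map_c₄ E₀ ι, ← map_c₆ E₀ ι, ← hE, ← hC, variableChange_c₄, variableChange_c₆, hu]
  have hu0 : (C.u : ℂ_[p]) ≠ 0 := C.u.ne_zero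
  field_simp

/-- **The value hypothesis `hυσ` at a non-split prime, in `ℂ_p`**:
`ι (σ_q²(cosh(logUnitParamSq W p q x y))) = θ(υ,q)²/υ` for a rational point `P = (x,y)` of `E₁(ℚ_p)`
with one-unit Tate parameter `υ ∈ ℂ_p`: `log_E(z(P)) = u⁻¹L(υ)` (N4), `ι(scale²) = u⁻²`, so
`ι(logUnitParamSq) = L(υ)²`; `cosh(L(υ)²) = (υ+υ⁻¹)/2` (`PadicAlgebra.coshOfSq_logSeries_sq`) and
`σ_q²((υ+υ⁻¹)/2) = θ(υ)²/υ` (`tateSigmaSq_cosh_eq`). [cite: SteinWuthrich2013, §4.2 (p. 15)] -/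
theorem tateSigmaSq_coshOfSq_logUnitParamSq_eq_padicComplex (hp2 : p ≠ 2) [W.IsElliptic]
    [W.IsIntegral ℤ] {q : ℚ_[p]} (hq0 : q ≠ 0) (hq : ‖q‖ < 1) (hj : 1 < ‖(W.j : ℚ_[p])‖)
    {C : VariableChange ℂ_[p]}
    (hC : C • (W.baseChange ℚ_[p]).map (algebraMap ℚ_[p] ℂ_[p]) = tateCurve (algebraMap ℚ_[p] ℂ_[p] q))
    (hu : ‖(C.u : ℂ_[p])‖ = 1) (hr : ‖C.r‖ ≤ 1) (hs : ‖C.s‖ ≤ 1) (ht : ‖C.t‖ ≤ 1) {x y : ℚ}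
    (hxy : W.toAffine.Nonsingular x y) {υ : ℂ_[p]} (hυ1 : ‖υ - 1‖ ≤ (p : ℝ)⁻¹) (hυne : υ ≠ 1)
    (hX : tateX (algebraMap ℚ_[p] ℂ_[p] q) υ = C.toX (algebraMap ℚ_[p] ℂ_[p] (x : ℚ_[p])))
    (hY : tateY (algebraMap ℚ_[p] ℂ_[p] q) υ =
      C.toY (algebraMap ℚ_[p] ℂ_[p] (x : ℚ_[p])) (algebraMap ℚ_[p] ℂ_[p] (y : ℚ_[p]))) :
    algebraMap ℚ_[p] ℂ_[p] (tateSigmaSq q (coshOfSq (logUnitParamSq W p q x y))) =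
      tateTheta (algebraMap ℚ_[p] ℂ_[p] q) υ ^ 2 / υ := by
  set ι := algebraMap ℚ_[p] ℂ_[p] with hι
  have hpinv1 : (p : ℝ)⁻¹ < 1 := inv_lt_one_of_one_lt₀ (by exact_mod_cast hp.out.one_lt)
  have hq' : ‖ι q‖ < 1 := by rw [norm_ι'']; exact hq
  have hu0 : (C.u : ℂ_[p]) ≠ 0 := C.u.ne_zero
  have hυn : ‖υ‖ = 1 := norm_eq_one_of_norm_sub_one_lt (hυ1.trans_lt hpinv1)
  have hυ0 : υ ≠ 0 := by intro h0; rw [h0, norm_zero] at hυn; exact zero_ne_one hυn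
  have h2 : (2 : ℂ_[p]) ≠ 0 := by
    have h := PadicAlgebra.norm_two_eq_one (p := p) (F := ℂ_[p]) hp2
    intro h0; rw [h0, norm_zero] at h; exact zero_ne_one h
  set L : ℂ_[p] := ∑' n : ℕ, -((1 - υ) ^ (n + 1)) / (n + 1 : ℂ_[p]) with hL
  have hlog := padicFormalLog_param_eq_inv_u_mul_logSeries W hq0 hq hC hu hr hs ht hxy hυ1 hυne hX hY
  rw [← hL] at hlog
  have hscale := algebraMap_uniformisationScaleSq hq hC hj
  -- `ι (logUnitParamSq) = L²`
  have hℓ : ι (logUnitParamSq W p q x y) = L ^ 2 := by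
    unfold logUnitParamSq
    rw [map_div₀, map_pow, hlog, hscale]
    field_simp
  -- `‖logUnitParamSq‖ ≤ p⁻²`
  have hLn : ‖L‖ ≤ ‖υ - 1‖ :=
    PadicAlgebra.norm_log_le (F := ℂ_[p]) hp2
      (Lg := fun v : ℂ_[p] => ∑' n : ℕ, -((1 - v) ^ (n + 1)) / (n + 1 : ℂ_[p]))
      (fun t ht => PadicAlgebra.norm_logSeries_one_add_sub_le ht) hυ1
  have hℓn : ‖logUnitParamSq W p q x y‖ ≤ ((p : ℝ)⁻¹) ^ 2 := by
    rw [← norm_ι'', hℓ, norm_pow]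
    exact pow_le_pow_left₀ (norm_nonneg _) (hLn.trans hυ1) 2
  rw [algebraMap_tateSigmaSq hq, algebraMap_coshOfSq hp2 hℓn, hℓ, hL,
    PadicAlgebra.coshOfSq_logSeries_sq (F := ℂ_[p]) hp2 hυ1, tateSigmaSq_cosh_eq hq' hυ0 h2]

/-! ### Assembly -/

/-- **The inputs `hS0`, `hΘ` of `exists_isMultCanonical_of_theta_nonsplit` at a multiplicative prime
`p ≠ 2`**, from the uniformisation over `ℂ_p` (`exists_nonsplitUniformizationData`), the value identity
in `ℂ_p` and Silverman's theta relation Prop. V.3.2 (b)(i) over `ℂ_p` (`TateCurve.tate_thetaRelation`),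
via `tateSigma_input_of_uniformization (K := ℂ_p)`. [cite: SteinWuthrich2013, §4.2 (pp. 15–16)]
[cite: SilvermanATAEC1994, Prop. V.3.2 (b) (PDF p. 399)] -/
theorem tateSigma_input_nonsplit [W.IsElliptic] [W.IsGloballyMinimal] (hp2 : p ≠ 2)
    (hmult : W.HasMultiplicativeReductionAtPrime p) {q : ℚ_[p]} (hq0 : q ≠ 0) (hq : ‖q‖ < 1)
    (hj : tateJ q = (W.j : ℚ_[p])) :
    (∀ {x y : ℚ} (_ : W.toAffine.Nonsingular x y), 1 < ‖(x : ℚ_[p])‖ →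
      uniformisationScaleSq W p q * tateSigmaSq q (coshOfSq (logUnitParamSq W p q x y)) ≠ 0) ∧
    (∀ {x₁ y₁ x₂ y₂ x₃ y₃ x₄ y₄ : ℚ} (h₁ : W.toAffine.Nonsingular x₁ y₁)
      (h₂ : W.toAffine.Nonsingular x₂ y₂) (h₃ : W.toAffine.Nonsingular x₃ y₃)
      (h₄ : W.toAffine.Nonsingular x₄ y₄), 1 < ‖(x₁ : ℚ_[p])‖ → 1 < ‖(x₂ : ℚ_[p])‖ → x₁ ≠ x₂ →
      (.some x₁ y₁ h₁ : W.toAffine.Point) + .some x₂ y₂ h₂ = .some x₃ y₃ h₃ →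
      (.some x₁ y₁ h₁ : W.toAffine.Point) - .some x₂ y₂ h₂ = .some x₄ y₄ h₄ →
        (uniformisationScaleSq W p q * tateSigmaSq q (coshOfSq (logUnitParamSq W p q x₃ y₃))) *
            (uniformisationScaleSq W p q * tateSigmaSq q (coshOfSq (logUnitParamSq W p q x₄ y₄))) =
          ((x₂ : ℚ_[p]) - x₁) ^ 2 *
            (uniformisationScaleSq W p q * tateSigmaSq q (coshOfSq (logUnitParamSq W p q x₁ y₁))) ^ 2 *
            (uniformisationScaleSq W p q *
              tateSigmaSq q (coshOfSq (logUnitParamSq W p q x₂ y₂))) ^ 2) := by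
  set ι := algebraMap ℚ_[p] ℂ_[p] with hι
  have hq' : ‖ι q‖ < 1 := by rw [norm_ι'']; exact hq
  have hq0' : ι q ≠ 0 := (map_ne_zero _).mpr hq0
  have hj1 := one_lt_norm_j_of_hasMultiplicativeReductionAtPrime (W := W) (p := p) hmult
  obtain ⟨C, υ, hC, hu, hr, hs, ht, hυ, hυadd, hυsub⟩ :=
    exists_nonsplitUniformizationData hp2 hmult hq0 hq hj
  have hu0 : (C.u : ℂ_[p]) ≠ 0 := C.u.ne_zero
  have hscale := algebraMap_uniformisationScaleSq hq hC hj1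
  refine tateSigma_input_of_uniformization (K := ℂ_[p]) ι hq0 hq'
    (fun u₁ u₂ hu₁ hu₂ h₁ h₂ => tate_thetaRelation hq0' hq' hu₁ hu₂ h₁ h₂)
    (C := (C.u : ℂ_[p])⁻¹) (-(((C.u : ℂ_[p])⁻¹) ^ 2 * C.r)) hscale.symm (inv_ne_zero hu0) υ
    (fun h hx => ⟨(hυ h hx).1, (hυ h hx).2.2.2.1⟩) (fun h hx => ?_) (fun h hx => ?_) hυadd hυsub
  · rw [(hυ h hx).2.2.2.2.1, VariableChange.toX_def, Units.val_inv_eq_inv_val]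
    ring
  · obtain ⟨-, hυ1, hυne, -, hX, hY⟩ := hυ h hx
    exact tateSigmaSq_coshOfSq_logUnitParamSq_eq_padicComplex hp2 hq0 hq hj1 hC hu hr hs ht h hυ1
      hυne hX hY

/-- **Stein–Wuthrich 2013 §4.2 / §6.1, existence of the canonical `p`-adic height at a NON-split
multiplicative prime `p ≠ 2`** (the named fact `exists_isMultCanonical`): for `W/ℚ` globally
minimal, `p ≠ 2` multiplicative and not split, and `q ∈ ℚ_p` with `0 < ‖q‖ < 1`, `tateJ q = j(W)`,
there is a `PAdicHeightData W p` whose pairing on `E₁(ℚ_p)`-admissible points is SW's formula (4.1).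
Proof: `exists_isMultCanonical_of_theta_nonsplit` + `tateSigma_input_nonsplit` (Tate uniformisation
over `ℂ_p` and Silverman's Prop. V.3.2 (b)(i)). [Stein–Wuthrich 2013, §4.2 (pp. 15–16), §6.1;
Silverman ATAEC Prop. V.3.2 (b)(i), Thm. V.5.3] [cite: SteinWuthrich2013, §4.2 (pp. 15–16)]
[cite: SilvermanATAEC1994, Prop. V.3.2 (b) (PDF p. 399)] -/
theorem exists_isMultCanonical_holds : exists_isMultCanonical :=
  exists_isMultCanonical_of_theta_nonsplit fun _W _ _ _p _ hp2 hmult _ _q hq0 hq hj =>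
    tateSigma_input_nonsplit hp2 hmult hq0 hq hj

end Literature.NumberTheory.EllipticCurves.SteinWuthrich2013

end
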